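import Summits.KontsevichZagierPeriods.KontsevichZagierPeriods.Theses.HurwitzMicroSectors
import Summits.KontsevichZagierPeriods.KontsevichZagierPeriods.Theorems.HurwitzMicroSectorsNormalFormPrinciplePiBoxTransfer

/-! TTRL-lite variant V2216 of stmt-KontsevichZagierPeriods-3869

Variant V2216 = `stub_boxRigidity` (the leaf `BoxRigidity` of `NormalFormPrinciple`: two representations
on open unit boxes with integrands of KZ's rational shape and equal values are KZ-equivalent) under the
TWO-sided move `fix_nat:m=2; bound_nat:m'≤4` (left dimension frozen to `2`, right dimension `≤ 4`).
Verdict of the attempt seat: **open** — this file is the exact-strength certificate, not a proof of the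
variant. With `BoxVanishing K` := "a box-rational representation of dimension `K` and value `0` is a
relation", the strength of a two-sided variant is `BoxVanishing` of the LARGEST dimension allowed, here
`max 2 4 = 4` (the bound sits on the free side, so unlike `…Variants2204` (`m = 2`, `m' ≤ 2`:
`BoxVanishing 2`) the frozen `m = 2` is idle):
* `V2216 ⟺ BoxVanishing 4` (`stub_boxRigidity_var2216_iff_boxVanishing_four`: (⇒) the pair `(2, 4)` is
  allowed — compare a vanishing `4`-dimensional representation with the zero representation on the
  `2`-box, itself a relation; (⇐) pad both sides by unit intervals to the `4`-box (`pad_le`, tree),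
  subtract there (`sub_same`, tree), the difference has value `0` by soundness);
* `V2216 ⟺ BoxRigidity for all m, m' ≤ 4` (`stub_boxRigidity_var2216_iff_le_four`) `⟺` the mirrored
  sibling `m ≤ 4, m' = 2` (`stub_boxRigidity_var2216_iff_mirror`);
* `V2216 ⇒ BoxVanishing j` for every `j ≤ 4` (`boxVanishing_le_four_of_stub_boxRigidity_var2216`), in
  particular the dimension-`2` statement that EVERY vanishing `ℚ`-linear combination of absolutely
  convergent `∫_{(0,1)²} P/Q` (`π²`, `log a · log b`, `π log 2`, `Li₂` at rationals, Catalan's `G`,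
  `L(2,χ)`, …) is generated by the four moves, and the dimension-`3`/`4` statements (`ζ(3)`, `π⁴`,
  `ζ(3) log 2`, `Li₄(1/2)`, …) — open: the tree's proved frontier is `BoxVanishing 1` (Baker,
  `boxRigidity_of_le_one`), its dimension-two layers are conditional on open independence inputs;
* conversely `KontsevichZagierPeriods ⇒ V2216` (`stub_boxRigidity_var2216_of_statement`), so a
  refutation of the variant would refute the Summit; no invariant of the four moves beyond `eval` is
  known.
Residual goal: `∀ (M : IntegralRep 4), M.domain = box → M.IsRational → M.value = 0 → of M ∈ relations`.
Source: M. Kontsevich, D. Zagier, *Periods* (2001), §1.2 Conjecture 1. Pure proof file, no definitions. -/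

-- `Summit.<Summit>.<Problem>` is the tree's mandated summit-side namespace (CONVENTIONS §2); for this
-- single-conjunct summit the two coincide, so the duplicate is deliberate.
set_option linter.dupNamespace false

noncomputable section

namespace Summit.KontsevichZagierPeriods.KontsevichZagierPeriods.Theorems

open MeasureTheory Set
open Literature.NumberTheory.Transcendental Literature.NumberTheory.Transcendental.KZ
open Summit.KontsevichZagierPeriods.KontsevichZagierPeriods.Theses.HurwitzMicroSectors
open Summit.KontsevichZagierPeriods.HurwitzMicroSectors.NormalFormPrinciple.PiBox
open Summit.KontsevichZagierPeriods.HurwitzMicroSectors.NormalFormPrinciple.PiBox.stub_boxCombineAux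
  (pad_le sub_same)

/-! ## Three general facts about `BoxVanishing K` (self-contained copies of the V2238 toolkit) -/

/-- The zero representation on the `k`-box is box-rational, has value `0`, and is a relation.
[cite: KontsevichZagier2001, §1.2] -/
private theorem exists_boxZero_v2216 (k : ℕ) :
    ∃ Z : IntegralRep k, Z.domain = {x | ∀ i, x i ∈ Set.Ioo (0:ℝ) 1} ∧ Z.IsRational ∧
      Z.value = 0 ∧ of Z ∈ relations := by
  obtain ⟨Z, hZd, hZi⟩ := exists_zeroRep (isSemialgebraic_box k)
  exact ⟨Z, hZd, ⟨0, 1, fun x _ => by simp, fun x _ => by simp [hZi]⟩,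
    by simp [IntegralRep.value, hZi], of_mem_relations_of_eqOn_zero Z (by simp [hZi, EqOn])⟩

/-- **`BoxVanishing` is monotone in the dimension**: pad a vanishing box-rational representation of
dimension `j ≤ K` to the `K`-box (`pad_le`); the value is unchanged by soundness.
[cite: KontsevichZagier2001, §1.2] -/
private theorem boxVanishing_mono_v2216 {j K : ℕ} (hjK : j ≤ K)
    (hvan : ∀ (M : IntegralRep K), M.domain = {x | ∀ i, x i ∈ Set.Ioo (0:ℝ) 1} → M.IsRational →
      M.value = 0 → of M ∈ relations)
    (N : IntegralRep j) (hNd : N.domain = {x | ∀ i, x i ∈ Set.Ioo (0:ℝ) 1}) (hNr : N.IsRational)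
    (hv : N.value = 0) : of N ∈ relations := by
  obtain ⟨R, hRd, hRr, hR⟩ := pad_le hjK N hNd hNr
  have hRv : R.value = 0 := by
    have e := relations_le_ker_eval_holds hR
    rw [AddMonoidHom.mem_ker, map_sub, eval_of, eval_of, hv, zero_sub, neg_eq_zero] at e
    exact e
  have := relations.add_mem hR (hvan R hRd hRr hRv)
  rwa [sub_add_cancel] at this

/-- **`BoxVanishing K` ⇒ rigidity for all dimensions `m, m' ≤ K`**: pad both representations to the
`K`-box, subtract the integrands there (rule 1b); the difference is box-rational of value `0` by
soundness, hence a relation. [cite: KontsevichZagier2001, §1.2 Conjecture 1] -/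
private theorem boxRigidityLe_of_boxVanishing_v2216 (K : ℕ)
    (hvan : ∀ (M : IntegralRep K), M.domain = {x | ∀ i, x i ∈ Set.Ioo (0:ℝ) 1} → M.IsRational →
      M.value = 0 → of M ∈ relations) :
    ∀ (m m' : ℕ) (N : IntegralRep m) (N' : IntegralRep m'), m ≤ K → m' ≤ K →
      N.domain = {x | ∀ i, x i ∈ Set.Ioo (0:ℝ) 1} → N.IsRational →
      N'.domain = {x | ∀ i, x i ∈ Set.Ioo (0:ℝ) 1} → N'.IsRational →
      N.value = N'.value → Equivalent N N' := by
  intro m m' N N' hm hm' hNd hNr hN'd hN'r hv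
  obtain ⟨R₁, h₁d, h₁r, h₁⟩ := pad_le hm N hNd hNr
  obtain ⟨R₂, h₂d, h₂r, h₂⟩ := pad_le hm' N' hN'd hN'r
  obtain ⟨M, hMd, hMr, hM⟩ := sub_same R₁ R₂ h₁d h₁r h₂d h₂r
  have hMv : M.value = 0 := by
    have e₁ := relations_le_ker_eval_holds h₁
    have e₂ := relations_le_ker_eval_holds h₂
    have e := relations_le_ker_eval_holds hM
    rw [AddMonoidHom.mem_ker, map_sub, eval_of, eval_of, sub_eq_zero] at e₁ e₂
    rw [AddMonoidHom.mem_ker, map_sub, map_sub, eval_of, eval_of, eval_of, ← e₁, ← e₂, hv, sub_self,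
      zero_sub, neg_eq_zero] at e
    exact e
  have e : of N - of N' = (of N - of R₁) - (of N' - of R₂) + (of R₁ - of R₂ - of M) + of M := by abel
  show of N - of N' ∈ relations
  rw [e]
  exact relations.add_mem (relations.add_mem (relations.sub_mem h₁ h₂) hM) (hvan M hMd hMr hMv)

/-! ## The variant V2216 itself: exactly `BoxVanishing 4` -/

/-- **V2216 ⟺ `BoxVanishing 4`**: (⇒) the pair `(2, 4)` is allowed, so a vanishing box-rational
`4`-dimensional representation is KZ-equivalent to the zero representation on the `2`-box, itself a
relation; (⇐) `boxRigidityLe_of_boxVanishing_v2216 4` with `m = 2 ≤ 4`, `m' ≤ 4`.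
[cite: KontsevichZagier2001, §1.2 Conjecture 1] -/
theorem stub_boxRigidity_var2216_iff_boxVanishing_four :
    (∀ (m' : ℕ) (N : IntegralRep 2) (N' : IntegralRep m'), m' ≤ 4 → N.domain = {x | ∀ i, x i ∈ Set.Ioo (0:ℝ) 1} → N.IsRational → N'.domain = {x | ∀ i, x i ∈ Set.Ioo (0:ℝ) 1} → N'.IsRational → N.value = N'.value → Equivalent N N') ↔
    (∀ (M : IntegralRep 4), M.domain = {x | ∀ i, x i ∈ Set.Ioo (0:ℝ) 1} → M.IsRational →
      M.value = 0 → of M ∈ relations) := by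
  refine ⟨fun h M hMd hMr hv => ?_,
    fun hvan m' N N' hm' => boxRigidityLe_of_boxVanishing_v2216 4 hvan 2 m' N N' (by norm_num) hm'⟩
  obtain ⟨Z, hZd, hZr, hZv, hZ⟩ := exists_boxZero_v2216 2
  have hZM : of Z - of M ∈ relations := h 4 Z M le_rfl hZd hZr hMd hMr (by rw [hv, hZv])
  have := relations.sub_mem hZ hZM
  rwa [sub_sub_cancel] at this

/-- **V2216 ⟺ `BoxRigidity` for all `m, m' ≤ 4`** (so V2216 coincides with the two-sided variant
`bound_nat:m≤4; bound_nat:m'≤4` and with every sibling `fix/bound m, m'` of maximum `4`; the frozen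
`m = 2` is idle). [cite: KontsevichZagier2001, §1.2 Conjecture 1] -/
theorem stub_boxRigidity_var2216_iff_le_four :
    (∀ (m' : ℕ) (N : IntegralRep 2) (N' : IntegralRep m'), m' ≤ 4 → N.domain = {x | ∀ i, x i ∈ Set.Ioo (0:ℝ) 1} → N.IsRational → N'.domain = {x | ∀ i, x i ∈ Set.Ioo (0:ℝ) 1} → N'.IsRational → N.value = N'.value → Equivalent N N') ↔
    (∀ (m m' : ℕ) (N : IntegralRep m) (N' : IntegralRep m'), m ≤ 4 → m' ≤ 4 →
      N.domain = {x | ∀ i, x i ∈ Set.Ioo (0:ℝ) 1} → N.IsRational →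
      N'.domain = {x | ∀ i, x i ∈ Set.Ioo (0:ℝ) 1} → N'.IsRational →
      N.value = N'.value → Equivalent N N') :=
  ⟨fun h => boxRigidityLe_of_boxVanishing_v2216 4 (stub_boxRigidity_var2216_iff_boxVanishing_four.1 h),
    fun h m' N N' hm' => h 2 m' N N' (by norm_num) hm'⟩

/-- **V2216 ⟺ the mirrored sibling `bound_nat:m≤4; fix_nat:m'=2`** (both are `BoxVanishing 4`).
[cite: KontsevichZagier2001, §1.2 Conjecture 1] -/
theorem stub_boxRigidity_var2216_iff_mirror :
    (∀ (m' : ℕ) (N : IntegralRep 2) (N' : IntegralRep m'), m' ≤ 4 → N.domain = {x | ∀ i, x i ∈ Set.Ioo (0:ℝ) 1} → N.IsRational → N'.domain = {x | ∀ i, x i ∈ Set.Ioo (0:ℝ) 1} → N'.IsRational → N.value = N'.value → Equivalent N N') ↔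
    (∀ (m : ℕ) (N : IntegralRep m) (N' : IntegralRep 2), m ≤ 4 →
      N.domain = {x | ∀ i, x i ∈ Set.Ioo (0:ℝ) 1} → N.IsRational →
      N'.domain = {x | ∀ i, x i ∈ Set.Ioo (0:ℝ) 1} → N'.IsRational →
      N.value = N'.value → Equivalent N N') := by
  rw [stub_boxRigidity_var2216_iff_boxVanishing_four]
  refine ⟨fun hvan m N N' hm => boxRigidityLe_of_boxVanishing_v2216 4 hvan m 2 N N' hm (by norm_num),
    fun h M hMd hMr hv => ?_⟩
  obtain ⟨Z, hZd, hZr, hZv, hZ⟩ := exists_boxZero_v2216 2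
  have hMZ : of M - of Z ∈ relations := h 4 M Z le_rfl hMd hMr hZd hZr (by rw [hv, hZv])
  simpa using relations.add_mem hMZ hZ

/-- **V2216 ⇒ `BoxVanishing` in every dimension `≤ 4`** (monotonicity), in particular the open
dimension-`2` and dimension-`3` vanishing statements for box-rational periods.
[cite: KontsevichZagier2001, §1.2 Conjecture 1] -/
theorem boxVanishing_le_four_of_stub_boxRigidity_var2216
    (h : ∀ (m' : ℕ) (N : IntegralRep 2) (N' : IntegralRep m'), m' ≤ 4 → N.domain = {x | ∀ i, x i ∈ Set.Ioo (0:ℝ) 1} → N.IsRational → N'.domain = {x | ∀ i, x i ∈ Set.Ioo (0:ℝ) 1} → N'.IsRational → N.value = N'.value → Equivalent N N')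
    {j : ℕ} (hj : j ≤ 4) (N : IntegralRep j) (hNd : N.domain = {x | ∀ i, x i ∈ Set.Ioo (0:ℝ) 1})
    (hNr : N.IsRational) (hv : N.value = 0) : of N ∈ relations :=
  boxVanishing_mono_v2216 hj (stub_boxRigidity_var2216_iff_boxVanishing_four.1 h) N hNd hNr hv

/-- **V2216 ⇒ the sibling V2238** (`fix_nat:m=3; bound_nat:m'≤2`, i.e. `BoxVanishing 3`) **and the
sibling V2204** (`fix_nat:m=2; bound_nat:m'≤2`, i.e. `BoxVanishing 2`): the two-sided siblings are
totally ordered by their largest dimension. [cite: KontsevichZagier2001, §1.2 Conjecture 1] -/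
theorem stub_boxRigidity_le_of_stub_boxRigidity_var2216
    (h : ∀ (m' : ℕ) (N : IntegralRep 2) (N' : IntegralRep m'), m' ≤ 4 → N.domain = {x | ∀ i, x i ∈ Set.Ioo (0:ℝ) 1} → N.IsRational → N'.domain = {x | ∀ i, x i ∈ Set.Ioo (0:ℝ) 1} → N'.IsRational → N.value = N'.value → Equivalent N N')
    {j k : ℕ} (hj : j ≤ 4) (hk : k ≤ 4) :
    ∀ (m' : ℕ) (N : IntegralRep j) (N' : IntegralRep m'), m' ≤ k → N.domain = {x | ∀ i, x i ∈ Set.Ioo (0:ℝ) 1} → N.IsRational → N'.domain = {x | ∀ i, x i ∈ Set.Ioo (0:ℝ) 1} → N'.IsRational → N.value = N'.value → Equivalent N N' :=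
  fun m' N N' hm' =>
    (stub_boxRigidity_var2216_iff_le_four.1 h) j m' N N' hj (hm'.trans hk)

/-- **The parent leaf ⇒ V2216** (specialisation). [cite: KontsevichZagier2001, §1.2 Conjecture 1] -/
theorem stub_boxRigidity_var2216_of_parent
    (h : ∀ (m m' : ℕ) (N : IntegralRep m) (N' : IntegralRep m'), N.domain = {x | ∀ i, x i ∈ Set.Ioo (0:ℝ) 1} → N.IsRational → N'.domain = {x | ∀ i, x i ∈ Set.Ioo (0:ℝ) 1} → N'.IsRational → N.value = N'.value → Equivalent N N') :
    ∀ (m' : ℕ) (N : IntegralRep 2) (N' : IntegralRep m'), m' ≤ 4 → N.domain = {x | ∀ i, x i ∈ Set.Ioo (0:ℝ) 1} → N.IsRational → N'.domain = {x | ∀ i, x i ∈ Set.Ioo (0:ℝ) 1} → N'.IsRational → N.value = N'.value → Equivalent N N' :=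
  fun m' N N' _ => h 2 m' N N'

/-- **`KontsevichZagierPeriods ⇒ V2216`**: the variant is a special case of Conjecture 1 for the tree's
calculus (`leaves_of_statement`) — so a refutation of the variant would refute the Summit.
[cite: KontsevichZagier2001, §1.2 Conjecture 1] -/
theorem stub_boxRigidity_var2216_of_statement (h : _root_.KontsevichZagierPeriods) :
    ∀ (m' : ℕ) (N : IntegralRep 2) (N' : IntegralRep m'), m' ≤ 4 → N.domain = {x | ∀ i, x i ∈ Set.Ioo (0:ℝ) 1} → N.IsRational → N'.domain = {x | ∀ i, x i ∈ Set.Ioo (0:ℝ) 1} → N'.IsRational → N.value = N'.value → Equivalent N N' :=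
  stub_boxRigidity_var2216_of_parent (leaves_of_statement h).1

/-- **V2216 under BoxVanishing 4 as a hypothesis** (the variant CLOSED MODULO its residual goal, stated
verbatim): this is the exact missing input. [cite: KontsevichZagier2001, §1.2 Conjecture 1] -/
theorem stub_boxRigidity_var2216_of_boxVanishing_four
    (hvan : ∀ (M : IntegralRep 4), M.domain = {x | ∀ i, x i ∈ Set.Ioo (0:ℝ) 1} → M.IsRational →
      M.value = 0 → of M ∈ relations) :
    ∀ (m' : ℕ) (N : IntegralRep 2) (N' : IntegralRep m'), m' ≤ 4 → N.domain = {x | ∀ i, x i ∈ Set.Ioo (0:ℝ) 1} → N.IsRational → N'.domain = {x | ∀ i, x i ∈ Set.Ioo (0:ℝ) 1} → N'.IsRational → N.value = N'.value → Equivalent N N' :=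
  stub_boxRigidity_var2216_iff_boxVanishing_four.2 hvan

end Summit.KontsevichZagierPeriods.KontsevichZagierPeriods.Theorems

end
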